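import Literature.Computability.Complexity.ClockedUniversalSimulationProofs
import Literature.Computability.Cryptography.ClassBQP
import HarnessLib

/-!
# Codes of clocked quantum machines: the clocked family, its gap and its language

Topic `Literature/Computability/QuantumComplexity`. The vocabulary of Schöning–Ladner style
*uniform / delayed diagonalization* over bounded-error quantum machines (Schöning 1982; Ladner
1975; for promise / randomized / quantum classes Dziemba 2017), in the tree's circuit model of
`BQP` (`Cryptography/ClassBQP.lean`: oracle-free Clifford+`T` families described from `1ⁿ` by a
deterministic machine, run on `|x⟩|0…0⟩`, measured on wire `0`):

* **codes.** Every string `e : List Bool` is a code, read as the record `e = ⟨1^C, prog⟩`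
  (`ClockedQCode.const e = C`, `ClockedQCode.prog e = prog`, constructor `ClockedQCode.mk`):
  `prog` is a program word for the tree's clocked universal interpreter
  `Complexity.ClockedUS.run` (`Complexity/ClockedUniversalSimulationProofs.lean`; Arora–Barak 2009,
  Thm. 1.9 in the clocked form of §1.4.1), i.e. the Gödel number of a *quantum-circuit generating*
  deterministic machine (Dziemba 2017, Def. 8 and the proof of Lemma 6), and `C` is its clock
  constant;
* **the clock.** For a clock `t : ℕ → ℕ` (the requesting route uses `t = (· ^ 2)`) the machine is
  run on `1ⁿ` with the budget `ClockedQCode.budget t e n = C · t n + C` (the `c · t + c` slack of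
  `Complexity.DTIME`; it also absorbs the linear overhead `haltAddr · X` of the interpreter,
  `ClockedUS.sim`), giving `ClockedQCode.output t e n : Option (List Bool)`;
* **the clocked family.** `ClockedQCode.family t e : QCircuitFamily cliffordT` uses, on inputs of
  length `n`, the oracle-free circuit whose standard description `QCircuit.sigmaEncode ⟨n, m, C⟩`
  was printed within the budget (`ClockedQCode.Describes`, unique by injectivity of the
  description, `ClockedQCode.circuitOf`), and a DEFAULT circuit otherwise — Dziemba's convention
  that clocked machines "obey their runtime specification for all inputs … aborting after the
  specified runtime with a default value as output" (2017, remark before Def. 8; proof of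
  Lemma 6); `ClockedQCode.IsHonest t e` records that no default was needed at any length;
* **gap and language.** `ClockedQCode.acceptProb t e x`, the predicate `ClockedQCode.IsGapped t e`
  (on EVERY input the acceptance probability is `≤ 1/3` or `≥ 2/3`, i.e. the extremal problem
  `P(M)` of the machine, Dziemba 2017 Def. 15, is a decision problem — "if the machine accepts
  with probability `≥ 2/3` or `≤ 1/3` on all inputs", loc. cit. §3.3), the decided language
  `ClockedQCode.lang t e = {x | 2/3 ≤ acceptProb}`, and the requested notion
  `GappedClockedQTMCode t = {e | IsGapped t e}`;
* **computable sequences of codes.** `ClockedQCode.IsComputableSeq e` for `e : ℕ → List Bool`: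
  some machine of the tree's model prints `e c` on `1ᶜ` (Dziemba 2017, Def. 20: "computability of
  the series means the computability of the function `i ↦ Mᵢ`"), with
  `isComputableSeq_iff_timeComputable`, `isComputableSeq_of_mem_FP`, `isComputableSeq_const`.

Proved API: uniqueness of decoding (`Describes.unique`, `circuitOf_eq`), oracle-freeness of the
clocked family (`isOracleFree_family`), determinism of the default (`acceptProb_nil`,
`acceptProb_of_not_describes`: at a length without a well-formed description the answer is `0` or
`1`, so gappedness is a condition on the described lengths only, `isGapped_iff_forall_describes`),
the deciding clauses of a gapped code (`IsGapped.decides`), and the BRIDGE from time-bounded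
description machines
(`output_mk_ecode`, via `ClockedUS.sim`): every oracle-free family whose description
`1ⁿ ↦ sigmaEncode ⟨n, ancillas n, circ n⟩` is `TimeComputable` within `C · t n + C` IS the clocked
family of an honest code (`exists_family_eq`), so a language it decides with the `(2/3, 1/3)`
gap is the language of an honest gapped code (`exists_code_of_decides` — for `t = (· ^ 2)` the
hypotheses are the requesting route's comprehension of quadratic-time-uniform languages); hence
every `L ∈ BQP` is the language of an honest gapped code for a polynomial clock
(`exists_code_of_mem_BQP`).

## What is deliberately NOT here

* "QTM" in the requested name: the codes are codes of circuit-GENERATING deterministic machines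
  (Dziemba's `BQP`-machines), not transition tables of Bernstein–Vazirani quantum Turing machines
  (whose amplitudes are arbitrary polynomial-time computable complex numbers and admit no Gödel
  numbering by strings); the two machine classes decide the same languages (Yao 1993;
  Nishimura–Ozawa 2002; tree `BQPQTM_eq_BQP`, `QuantumTuring.lean`).
* Uniformity of `family t e` for an ARBITRARY code (hence `lang t e ∈ BQP` for gapped `e` and
  polynomially bounded `t`) needs a polynomial-time recogniser of well-formed descriptions
  (a parser of `sigmaEncode` strings), not in the tree; for HONEST codes the printed string is
  the description itself. Padding into the clock `(· ^ 2)` is the requesting route's own item.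
* No bridge between `IsComputableSeq` (the tree's `Turing.TM2` model) and Mathlib's `Computable`
  (partial recursive functions) is claimed; none exists in the tree.

## References

* U. Schöning, *A uniform approach to obtain diagonal sets in complexity classes*, Theoret.
  Comput. Sci. 18 (1982) 95–103 (recursively presentable classes, uniform diagonalization)
  [Schoning1982].
* R. E. Ladner, *On the structure of polynomial time reducibility*, J. ACM 22 (1975) 155–171
  (delayed diagonalization over clocked machines) [Ladner1975].
* F. A. Dziemba, *Uniform diagonalization theorem for complexity classes of promise problems
  including randomized and quantum classes*, arXiv:1712.07276 (2017), §2.3 Def. 8, §3.1 Def. 15,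
  §3.3 Def. 20 and Lemma 6 [Dziemba2017].
* S. Arora, B. Barak, *Computational Complexity: A Modern Approach*, CUP 2009, Thm. 1.9, §1.4.1
  (clocked universal machine), Def. 1.12 (`DTIME` with `c · T(n)`), §3.4 (Ladner's theorem)
  [AroraBarak2009].
* E. Bernstein, U. Vazirani, *Quantum complexity theory*, SIAM J. Comput. 26 (1997), Def. 8 and §8
  [BernsteinVazirani1997].
-/

noncomputable section

namespace Literature.Computability.QuantumComplexity

open _root_.Computability Complexity Complexity.Brick Cryptography

namespace ClockedQCode

/-! ### Codes: clock constant and program word -/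

/-- The clock constant `C` of the code `e = ⟨1^C, prog⟩`: the length of the first field (so that
every string is a code; Dziemba's index pair (machine, clock)).
[cite: Dziemba2017, §3.3 Lemma 6 (proof)] -/
def const (e : List Bool) : ℕ := (fstF e).length

/-- The program word `prog` of the code `e = ⟨1^C, prog⟩`: a program word for the clocked
universal interpreter `Complexity.ClockedUS.run`, i.e. the Gödel number of a circuit-generating
deterministic machine ("interpreting Gödel numbers as encodings of … quantum circuit
generating Turing machines"). [cite: Dziemba2017, §3.3 Lemma 6 (proof)] -/
def prog (e : List Bool) : List Bool := sndF e

/-- The code with clock constant `C` and program word `w`: `⟨1^C, w⟩`. [cite: Dziemba2017, §3.3 Lemma 6 (proof)] -/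
def mk (C : ℕ) (w : List Bool) : List Bool := boolPair (unaryEncodeNat C) w

/-- `const ⟨1^C, w⟩ = C`. [folklore] -/
@[simp] theorem const_mk (C : ℕ) (w : List Bool) : const (mk C w) = C := by
  simp [const, mk, unary_decode_encode_nat C, ← unaryDecodeNat.eq_1]

/-- `prog ⟨1^C, w⟩ = w`. [folklore] -/
@[simp] theorem prog_mk (C : ℕ) (w : List Bool) : prog (mk C w) = w := by
  simp [prog, mk]

/-- **The budget** of the code `e` on inputs of length `n` for the clock `t`: `C · t n + C` with
`C = const e`, passed as the time bound `T` of the clocked universal interpreter `ClockedUS.run`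
(the `c · t + c` form of `Complexity.DTIME`; for the requesting route `t = (· ^ 2)`, "clocked
`n²`"). [cite: AroraBarak2009, Def. 1.12 and §1.4.1] -/
def budget (t : ℕ → ℕ) (e : List Bool) (n : ℕ) : ℕ := const e * t n + const e

/-- The budget of `⟨1^C, w⟩`. [folklore] -/
@[simp] theorem budget_mk (t : ℕ → ℕ) (C : ℕ) (w : List Bool) (n : ℕ) :
    budget t (mk C w) n = C * t n + C := by
  simp [budget]

/-! ### The clocked run of a code -/

/-- **The clocked run** of the code `e` on `1ⁿ`: the output of the clocked universal interpreter
`ClockedUS.run` on the program word `⟨prog e, 1ⁿ⟩` with time bound `budget t e n` (`none` if the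
simulated machine has not halted within the bound — "counting the computational steps and
aborting after the specified runtime"). [cite: Dziemba2017, §2.3 (remark before Def. 8)] -/
def output (t : ℕ → ℕ) (e : List Bool) (n : ℕ) : Option (List Bool) :=
  ClockedUS.run (boolPair (prog e) (unaryEncodeNat n)) (budget t e n)

/-! ### Decoding the printed description -/

/-- `Describes n y mc`: the clocked output `y` is the standard description
`sigmaEncode ⟨n, m, C⟩` (input width in binary, ancilla count in unary, gate list) of the
ORACLE-FREE circuit `mc = ⟨m, C⟩` on `n + m` wires (the machine "outputs the encoding of the
gates"). [cite: Dziemba2017, §2.3 Def. 8] -/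
def Describes (n : ℕ) (y : Option (List Bool)) (mc : Σ m : ℕ, QCircuit cliffordT (n + m)) : Prop :=
  mc.2.IsOracleFree ∧ y = some (QCircuit.sigmaEncode (G := cliffordT) ⟨n, mc.1, mc.2⟩)

/-- A printed string describes at most one circuit (the description is injective,
`QCircuit.sigmaEncode_injective`). [folklore] -/
theorem Describes.unique {n : ℕ} {y : Option (List Bool)} {mc mc' : Σ m : ℕ, QCircuit cliffordT (n + m)}
    (h : Describes n y mc) (h' : Describes n y mc') : mc = mc' := by
  obtain ⟨m, C⟩ := mc
  obtain ⟨m', C'⟩ := mc'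
  have he : QCircuit.sigmaEncode (G := cliffordT) ⟨n, m, C⟩ = QCircuit.sigmaEncode (G := cliffordT) ⟨n, m', C'⟩ :=
    Option.some_injective _ (h.2.symm.trans h'.2)
  have hinj := QCircuit.sigmaEncode_injective he
  simp only [Sigma.mk.injEq, heq_eq_eq, true_and] at hinj
  obtain ⟨hm, hC⟩ := hinj
  subst hm
  simp only [heq_eq_eq] at hC
  subst hC
  rfl

/-- **The default circuit**: no ancillas, no gates (the identity; measuring wire `0` of `|x⟩`
returns the first input bit, so the default accepts `x` iff `x` starts with `1` — a gapped
behaviour). This is the "default value as output" of a clocked machine that has not printed a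
well-formed description in time. [cite: Dziemba2017, §2.3 (remark before Def. 8) and §3.3 Lemma 6 (proof)] -/
def defaultCircuit (n : ℕ) : Σ m : ℕ, QCircuit cliffordT (n + m) := ⟨0, ⟨[]⟩⟩

/-- The default circuit is oracle-free. [folklore] -/
theorem isOracleFree_defaultCircuit (n : ℕ) : (defaultCircuit n).2.IsOracleFree :=
  fun _ hg => absurd hg List.not_mem_nil

/-- **The circuit described by a clocked output** at input width `n`: the unique oracle-free
circuit whose description was printed, and the default circuit if none was. [cite: Dziemba2017, §2.3 Def. 8 and §3.3 Lemma 6 (proof)] -/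
def circuitOf (n : ℕ) (y : Option (List Bool)) : Σ m : ℕ, QCircuit cliffordT (n + m) :=
  open scoped Classical in
  if h : ∃ mc, Describes n y mc then h.choose else defaultCircuit n

/-- A described circuit is the circuit of the output. [folklore] -/
theorem circuitOf_eq {n : ℕ} {y : Option (List Bool)} {mc : Σ m : ℕ, QCircuit cliffordT (n + m)}
    (h : Describes n y mc) : circuitOf n y = mc := by
  have hex : ∃ mc, Describes n y mc := ⟨mc, h⟩
  rw [circuitOf, dif_pos hex]
  exact hex.choose_spec.unique h

/-- Without a described circuit the output decodes to the default circuit. [folklore] -/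
theorem circuitOf_of_not {n : ℕ} {y : Option (List Bool)} (h : ¬ ∃ mc, Describes n y mc) :
    circuitOf n y = defaultCircuit n := by
  rw [circuitOf, dif_neg h]

/-- A run that printed nothing decodes to the default circuit. [folklore] -/
theorem circuitOf_none (n : ℕ) : circuitOf n none = defaultCircuit n :=
  circuitOf_of_not fun ⟨_, h⟩ => Option.some_ne_none _ h.2.symm

/-- The decoded circuit is oracle-free (by the definition of `Describes`, resp. of the default).
[folklore] -/
theorem isOracleFree_circuitOf (n : ℕ) (y : Option (List Bool)) : (circuitOf n y).2.IsOracleFree := by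
  by_cases h : ∃ mc, Describes n y mc
  · rw [circuitOf, dif_pos h]
    exact h.choose_spec.1
  · rw [circuitOf_of_not h]
    exact isOracleFree_defaultCircuit n

/-! ### The clocked family of a code; acceptance probability, gap, language -/

/-- **The clocked family of the code `e`** for the clock `t`: on inputs of length `n`, the circuit
described by the clocked run of `e` on `1ⁿ` (default circuit if none) — the "bounded-runtime
generated family of quantum circuits" of the machine coded by `e`.
[cite: Dziemba2017, §2.3 Def. 8 and remark before it] -/
def family (t : ℕ → ℕ) (e : List Bool) : QCircuitFamily cliffordT where
  ancillas n := (circuitOf n (output t e n)).1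
  circ n := (circuitOf n (output t e n)).2

/-- The clocked family is oracle-free. [folklore] -/
theorem isOracleFree_family (t : ℕ → ℕ) (e : List Bool) : (family t e).IsOracleFree :=
  fun n => isOracleFree_circuitOf n (output t e n)

/-- **The acceptance probability** of the code `e` (clock `t`) on the input `x`: run the clocked
circuit for length `|x|` on `|x⟩|0…0⟩` and measure wire `0`.
[cite: Dziemba2017, §2.3 Def. 8] -/
def acceptProb (t : ℕ → ℕ) (e : List Bool) (x : List Bool) : ℝ :=
  (family t e).acceptProbOn 0 x

/-- Acceptance probabilities are nonnegative. [folklore] -/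
theorem acceptProb_nonneg (t : ℕ → ℕ) (e : List Bool) (x : List Bool) : 0 ≤ acceptProb t e x :=
  QCircuitFamily.acceptProbOn_nonneg _ _ _

/-- **The default circuit is deterministic**: the empty circuit maps `|x⟩` to itself, so wire `0`
reads the first input bit — acceptance probability `1` if `x` starts with `1`, else `0` (and `0`
on the empty register). [folklore] -/
theorem acceptProb_nil (n : ℕ) (x : QReg n) :
    QCircuit.acceptProb (0 : Language Bool) (⟨[]⟩ : QCircuit cliffordT (n + 0)) x =
      if h : 0 < n + 0 then (if x ⟨0, lt_of_lt_of_eq h (Nat.add_zero n)⟩ then 1 else 0) else 0 := by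
  unfold QCircuit.acceptProb
  simp only [QCircuit.runOn, QCircuit.toMatrix_nil, Matrix.one_mulVec, basisState_apply]
  by_cases h0 : 0 < n + 0
  · simp only [h0, dif_pos]
    have hpad : padInput x 0 ⟨0, h0⟩ = x ⟨0, lt_of_lt_of_eq h0 (Nat.add_zero n)⟩ :=
      Fin.append_left x (fun _ => false) ⟨0, lt_of_lt_of_eq h0 (Nat.add_zero n)⟩
    rw [Finset.sum_eq_single (padInput x 0)]
    · by_cases hy : padInput x 0 ⟨0, h0⟩ = true
      · simp [hy, hpad.symm.trans hy]
      · have hx : ¬ x ⟨0, lt_of_lt_of_eq h0 (Nat.add_zero n)⟩ = true := fun hx => hy (hpad.trans hx)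
        simp [hy, hx]
    · intro z _ hz
      simp [hz]
    · intro hy
      exact absurd (Finset.mem_univ _) hy
  · simp only [h0, dif_neg, not_false_eq_true, Finset.sum_const_zero]

/-- **At a length where nothing was described, the code answers deterministically**: the default
circuit is used, whose acceptance probability is `0` or `1`. [folklore] -/
theorem acceptProb_of_not_describes {t : ℕ → ℕ} {e x : List Bool}
    (h : ¬ ∃ mc, Describes x.length (output t e x.length) mc) :
    acceptProb t e x = 0 ∨ acceptProb t e x = 1 := by
  have hc : circuitOf x.length (output t e x.length) = ⟨0, ⟨[]⟩⟩ := circuitOf_of_not h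
  have key : acceptProb t e x =
      QCircuit.acceptProb (0 : Language Bool) (⟨[]⟩ : QCircuit cliffordT (x.length + 0)) x.get := by
    show QCircuit.acceptProb (0 : Language Bool) (circuitOf x.length (output t e x.length)).2 x.get = _
    rw [hc]
  rw [key, acceptProb_nil]
  by_cases h0 : 0 < x.length + 0
  · rw [dif_pos h0]
    by_cases hx : x.get ⟨0, lt_of_lt_of_eq h0 (Nat.add_zero _)⟩ = true
    · exact Or.inr (if_pos hx)
    · exact Or.inl (if_neg hx)
  · exact Or.inl (dif_neg h0)

/-- **Gapped codes.** `IsGapped t e`: on EVERY input the acceptance probability of the clocked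
machine lies outside the open interval `(1/3, 2/3)` — equivalently, the extremal problem `P(M)`
of the machine (yes: `P_acc ≥ 2/3`, no: `P_acc ≤ 1/3`) is a decision problem ("the machine
accepts with probability `≥ 2/3` or `≤ 1/3` on all inputs"). This semantic condition is what
separates the syntactic enumeration of clocked machines from a presentation of `BQP`.
[cite: Dziemba2017, §3.1 Def. 15 and §3.3 (remark after Cor. 2)] -/
def IsGapped (t : ℕ → ℕ) (e : List Bool) : Prop :=
  ∀ x : List Bool, acceptProb t e x ≤ 1 / 3 ∨ 2 / 3 ≤ acceptProb t e x

/-- The gap holds automatically at the lengths where the default circuit is used. [folklore] -/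
theorem gap_of_not_describes {t : ℕ → ℕ} {e x : List Bool}
    (h : ¬ ∃ mc, Describes x.length (output t e x.length) mc) :
    acceptProb t e x ≤ 1 / 3 ∨ 2 / 3 ≤ acceptProb t e x := by
  rcases acceptProb_of_not_describes h with h0 | h1
  · exact Or.inl (by rw [h0]; norm_num)
  · exact Or.inr (by rw [h1]; norm_num)

/-- **Gappedness is a condition on the described lengths only**: a code is gapped iff its
acceptance probability avoids `(1/3, 2/3)` on the inputs whose length received a well-formed
description within the clock. [folklore] -/
theorem isGapped_iff_forall_describes {t : ℕ → ℕ} {e : List Bool} :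
    IsGapped t e ↔ ∀ x : List Bool, (∃ mc, Describes x.length (output t e x.length) mc) →
      (acceptProb t e x ≤ 1 / 3 ∨ 2 / 3 ≤ acceptProb t e x) := by
  refine ⟨fun h x _ => h x, fun h x => ?_⟩
  by_cases hx : ∃ mc, Describes x.length (output t e x.length) mc
  · exact h x hx
  · exact gap_of_not_describes hx

/-- **The language of a code**, `L(e) = {x | P_acc(x) ≥ 2/3}` (the yes-part of the extremal
problem; for a gapped code its complement is the no-part). [cite: Dziemba2017, §3.1 Def. 15] -/
def lang (t : ℕ → ℕ) (e : List Bool) : Language Bool :=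
  {x | 2 / 3 ≤ acceptProb t e x}

/-- Membership in the language of a code (definitional). [folklore] -/
theorem mem_lang_iff {t : ℕ → ℕ} {e x : List Bool} : x ∈ lang t e ↔ 2 / 3 ≤ acceptProb t e x :=
  Iff.rfl

/-- For a gapped code, non-membership is acceptance probability `≤ 1/3`. [cite: Dziemba2017, §3.1 Def. 15] -/
theorem IsGapped.not_mem_lang_iff {t : ℕ → ℕ} {e : List Bool} (h : IsGapped t e) {x : List Bool} :
    x ∉ lang t e ↔ acceptProb t e x ≤ 1 / 3 := by
  rw [mem_lang_iff, not_le]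
  refine ⟨fun hx => ?_, fun hx => by linarith⟩
  rcases h x with h1 | h2
  · exact h1
  · exact absurd h2 (not_le.2 hx)

/-- **A gapped code decides its language with error `≤ 1/3`** in the format of `BQPWith`:
acceptance probability `≥ 2/3` on members, `≤ 1/3` on non-members. [cite: Dziemba2017, §2.3 Def. 8] -/
theorem IsGapped.decides {t : ℕ → ℕ} {e : List Bool} (h : IsGapped t e) (x : List Bool) :
    (x ∈ lang t e → 2 / 3 ≤ (family t e).acceptProbOn 0 x) ∧
      (x ∉ lang t e → (family t e).acceptProbOn 0 x ≤ 1 / 3) :=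
  ⟨fun hx => hx, fun hx => h.not_mem_lang_iff.1 hx⟩

/-- **Honest codes.** `IsHonest t e`: at every input length the clocked run prints a well-formed
description of an oracle-free circuit of the right input width (so the default is never used
and the printed string IS the description of the clocked family). A convenience predicate: the
machines constructed from time-bounded description machines are honest (`exists_family_eq`).
[folklore] -/
def IsHonest (t : ℕ → ℕ) (e : List Bool) : Prop :=
  ∀ n, ∃ mc, Describes n (output t e n) mc

/-- For an honest code the clocked output at length `n` is the description of the `n`-th circuit
of its clocked family. [folklore] -/
theorem IsHonest.output_eq {t : ℕ → ℕ} {e : List Bool} (h : IsHonest t e) (n : ℕ) :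
    output t e n = some (QCircuit.sigmaEncode (G := cliffordT)
      ⟨n, (family t e).ancillas n, (family t e).circ n⟩) := by
  obtain ⟨mc, hmc⟩ := h n
  have hc : circuitOf n (output t e n) = mc := circuitOf_eq hmc
  show output t e n = some (QCircuit.sigmaEncode (G := cliffordT)
    ⟨n, (circuitOf n (output t e n)).1, (circuitOf n (output t e n)).2⟩)
  rw [hc]
  exact hmc.2

/-! ### Honest codes from time-bounded description machines -/

/-- Two circuit families agree as soon as they agree length by length as dependent pairs
`⟨ancillas n, circ n⟩` (extensionality for the structure `QCircuitFamily` of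
`Cryptography/QuantumCircuit.lean`; a deliberate dot-notation extension). [folklore] -/
theorem _root_.Literature.Computability.Cryptography.QCircuitFamily.ext_sigma {G : QGateSet}
    {F F' : QCircuitFamily G}
    (h : ∀ n, (⟨F.ancillas n, F.circ n⟩ : Σ m : ℕ, QCircuit G (n + m)) = ⟨F'.ancillas n, F'.circ n⟩) :
    F = F' := by
  obtain ⟨a, c⟩ := F
  obtain ⟨a', c'⟩ := F'
  have ha : a = a' := funext fun n => congrArg Sigma.fst (h n)
  subst ha
  have hc : c = c' := by
    funext n
    have hn := h n
    simp only [Sigma.mk.injEq, heq_eq_eq, true_and] at hn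
    exact hn
  subst hc
  rfl

/-- **The clocked run of the code of a machine** (bridge to `ClockedUS.sim`): if the machine `M`
prints `y` on `1ⁿ` within `C · t n + C` steps, then the code `⟨1^{A C}, ecode M⟩`, `A` the length
of the flat program of `M` (the linear overhead `haltAddr · X` of the interpreter), outputs `y` at
length `n` under the clock `t`. [cite: AroraBarak2009, Thm. 1.9 and §1.4.1] -/
theorem output_mk_ecode (M : Turing.TM2ComputableAux Bool Bool) {t : ℕ → ℕ} {C n : ℕ} {y : List Bool}
    (h : M.OutputsWithin (unaryEncodeNat n) y (C * t n + C)) :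
    output t (mk (FlatProg.haltAddr (ClockedUA.cM M) * C) (ClockedUS.ecode M)) n = some y := by
  have hsim := ClockedUS.sim M h
  have hev : (ClockedUA.pM M).eval (C * t n + C) = FlatProg.haltAddr (ClockedUA.cM M) * (C * t n + C) := by
    simp [ClockedUA.pM]
  rw [hev] at hsim
  rw [output, prog_mk, budget_mk]
  have hb : FlatProg.haltAddr (ClockedUA.cM M) * C * t n + FlatProg.haltAddr (ClockedUA.cM M) * C =
      FlatProg.haltAddr (ClockedUA.cM M) * (C * t n + C) := by ring
  rw [hb]
  exact hsim

/-- **Every time-`(C · t + C)` described oracle-free family is the clocked family of an honest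
code.** If `F` is oracle-free and its description `1ⁿ ↦ sigmaEncode ⟨n, ancillas n, circ n⟩` is
computable within `C · t n + C` steps (the uniformity format of the requesting route, there with
`t = (· ^ 2)`), then `F = family t e` for an honest code `e` (the code of the describing machine
with the interpreter's overhead folded into the clock constant).
[cite: Dziemba2017, §3.3 Lemma 6 (proof)] -/
theorem exists_family_eq {t : ℕ → ℕ} {F : QCircuitFamily cliffordT} (hF : F.IsOracleFree) {C : ℕ}
    (h : TimeComputable unaryEncodeNat (QCircuit.sigmaEncode (G := cliffordT))
      (fun n => (⟨n, F.ancillas n, F.circ n⟩ : Σ n m : ℕ, QCircuit cliffordT (n + m)))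
      (fun n => C * t n + C)) :
    ∃ e, IsHonest t e ∧ family t e = F := by
  obtain ⟨M, hM⟩ := h
  set e := mk (FlatProg.haltAddr (ClockedUA.cM M) * C) (ClockedUS.ecode M) with he
  have hout : ∀ n, output t e n = some (QCircuit.sigmaEncode (G := cliffordT) ⟨n, F.ancillas n, F.circ n⟩) := by
    intro n
    have hn := hM n
    have hlen : (unaryEncodeNat n).length = n := unary_decode_encode_nat n
    simp only [hlen] at hn
    exact output_mk_ecode M hn
  have hdesc : ∀ n, Describes n (output t e n) ⟨F.ancillas n, F.circ n⟩ := fun n => ⟨hF n, hout n⟩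
  refine ⟨e, fun n => ⟨_, hdesc n⟩, QCircuitFamily.ext_sigma fun n => ?_⟩
  exact circuitOf_eq (hdesc n)

/-- **A language decided with the `(2/3, 1/3)` gap by a time-`(C · t + C)` described oracle-free
family is the language of an honest gapped code** (clock `t`), whose clocked family is that
family. With `t = (· ^ 2)` the hypotheses are verbatim the comprehension defining the
quadratic-time-uniform Clifford+`T` languages of the requesting route. [cite: Dziemba2017, §3.3 Lemma 6 (proof)] -/
theorem exists_code_of_decides {t : ℕ → ℕ} {F : QCircuitFamily cliffordT} (hF : F.IsOracleFree)
    {C : ℕ} (h : TimeComputable unaryEncodeNat (QCircuit.sigmaEncode (G := cliffordT))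
      (fun n => (⟨n, F.ancillas n, F.circ n⟩ : Σ n m : ℕ, QCircuit cliffordT (n + m)))
      (fun n => C * t n + C))
    {L : Language Bool}
    (hdec : ∀ x, (x ∈ L → 2 / 3 ≤ F.acceptProbOn 0 x) ∧ (x ∉ L → F.acceptProbOn 0 x ≤ 1 / 3)) :
    ∃ e, IsHonest t e ∧ IsGapped t e ∧ lang t e = L ∧ family t e = F := by
  obtain ⟨e, hhon, hfam⟩ := exists_family_eq hF h
  refine ⟨e, hhon, fun x => ?_, Language.ext fun x => ?_, hfam⟩
  · by_cases hx : x ∈ L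
    · exact Or.inr (by rw [acceptProb, hfam]; exact (hdec x).1 hx)
    · exact Or.inl (by rw [acceptProb, hfam]; exact (hdec x).2 hx)
  · rw [mem_lang_iff, acceptProb, hfam]
    refine ⟨fun hx => ?_, fun hx => (hdec x).1 hx⟩
    by_contra hxL
    have h2 := (hdec x).2 hxL
    linarith

/-- **Every `BQP` language is the language of an honest gapped code for a polynomial clock**:
unfold `L ∈ BQP` into a poly-time uniform oracle-free family with the `(2/3, 1/3)` gap, and apply
`exists_code_of_decides` with the clock `n ↦ p(n)` and constant `1`. (Non-vacuity of the notions;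
the converse, `lang t e ∈ BQP` for gapped codes and polynomially bounded clocks, needs a
polynomial-time recogniser of well-formed descriptions and is not proved here.)
[cite: Dziemba2017, §3.3 Lemma 6] -/
theorem exists_code_of_mem_BQP {L : Language Bool} (hL : L ∈ BQP) :
    ∃ (p : Polynomial ℕ) (e : List Bool), IsHonest (fun n => p.eval n) e ∧
      IsGapped (fun n => p.eval n) e ∧ lang (fun n => p.eval n) e = L := by
  obtain ⟨F, hF, ⟨p, hp⟩, hdec⟩ := ClassBQP.mem_BQP_iff.1 hL
  have hp' : TimeComputable unaryEncodeNat (QCircuit.sigmaEncode (G := cliffordT))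
      (fun n => (⟨n, F.ancillas n, F.circ n⟩ : Σ n m : ℕ, QCircuit cliffordT (n + m)))
      (fun n => 1 * (fun n => p.eval n) n + 1) :=
    hp.mono fun n => by simp
  obtain ⟨e, hhon, hgap, hlang, -⟩ := exists_code_of_decides hF hp' hdec
  exact ⟨p, e, hhon, hgap, hlang⟩

/-! ### Computable sequences of codes -/

/-- **Computable sequences of codes.** `IsComputableSeq e`: some machine of the tree's model
(`Turing.TM2ComputableAux Bool Bool`, halting convention of `OutputsWithin`) prints the code
`e c` on the unary input `1ᶜ`, for every `c` (no time bound: plain computability of `c ↦ e_c`).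
[cite: Dziemba2017, §3.3 Def. 20 and the remark following it] -/
def IsComputableSeq (e : ℕ → List Bool) : Prop :=
  ∃ M : Turing.TM2ComputableAux Bool Bool, ∀ c, ∃ T, M.OutputsWithin (unaryEncodeNat c) (e c) T

/-- A sequence of codes is computable iff it is `TimeComputable` (from `1ᶜ`, identity output
encoding) for SOME time function. [folklore] -/
theorem isComputableSeq_iff_timeComputable {e : ℕ → List Bool} :
    IsComputableSeq e ↔ ∃ t : ℕ → ℕ, TimeComputable unaryEncodeNat (fun w : List Bool => w) e t := by
  constructor
  · rintro ⟨M, hM⟩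
    choose T hT using hM
    refine ⟨T, M, fun c => ?_⟩
    have hlen : (unaryEncodeNat c).length = c := unary_decode_encode_nat c
    simp only [hlen]
    exact hT c
  · rintro ⟨t, M, hM⟩
    exact ⟨M, fun c => ⟨_, hM c⟩⟩

/-- A sequence read off a polynomial-time string function along `c ↦ 1ᶜ` is computable.
[folklore] -/
theorem isComputableSeq_of_mem_FP {g : List Bool → List Bool} (hg : g ∈ FP) :
    IsComputableSeq fun c => g (unaryEncodeNat c) := by
  obtain ⟨p, M, hM⟩ := hg
  exact ⟨M, fun c => ⟨_, hM (unaryEncodeNat c)⟩⟩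

/-- Constant sequences of codes are computable. [folklore] -/
theorem isComputableSeq_const (e₀ : List Bool) : IsComputableSeq fun _ => e₀ :=
  isComputableSeq_of_mem_FP (const_mem_FP e₀)

end ClockedQCode

/-! ### The requested notion -/

/-- **Gapped clocked quantum-machine codes** (`GappedClockedQTMCode t`, requested by route
`CompactnessLift` of `QuantumAdvantage` with the clock `t = (· ^ 2)`): the strings `e` coding a
clocked (time bound `const e · t n + const e` on `1ⁿ`) circuit-generating machine whose
clocked Clifford+`T` family is `(2/3, 1/3)`-gapped on every input (`ClockedQCode.IsGapped`); its
language is `ClockedQCode.lang t e`, and computable sequences `c ↦ e_c` of such codes are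
`ClockedQCode.IsComputableSeq`. "QTM" is by metonymy: these are Dziemba's `BQP`-machines
(circuit model), equal in power to clocked quantum Turing machines (Yao 1993; Nishimura–Ozawa
2002). [cite: Dziemba2017, §2.3 Def. 8, §3.1 Def. 15 and §3.3 Lemma 6] -/
def GappedClockedQTMCode (t : ℕ → ℕ) : Set (List Bool) :=
  {e | ClockedQCode.IsGapped t e}

/-- Membership in `GappedClockedQTMCode t` is gappedness (definitional). [folklore] -/
theorem mem_gappedClockedQTMCode_iff {t : ℕ → ℕ} {e : List Bool} :
    e ∈ GappedClockedQTMCode t ↔ ClockedQCode.IsGapped t e :=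
  Iff.rfl

/-- Every `BQP` language is the language of a member of `GappedClockedQTMCode (p ·)` for some
polynomial clock `p` (non-vacuity). [cite: Dziemba2017, §3.3 Lemma 6] -/
theorem exists_mem_gappedClockedQTMCode_of_mem_BQP {L : Language Bool} (hL : L ∈ BQP) :
    ∃ (p : Polynomial ℕ) (e : List Bool), e ∈ GappedClockedQTMCode (fun n => p.eval n) ∧
      ClockedQCode.lang (fun n => p.eval n) e = L := by
  obtain ⟨p, e, -, hg, hl⟩ := ClockedQCode.exists_code_of_mem_BQP hL
  exact ⟨p, e, hg, hl⟩

end Literature.Computability.QuantumComplexity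

end
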